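import Literature.AlgebraicGeometry.Motives.HodgeLieWeightOnePlusPairTwinIdeal
import HarnessLib

/-!
# Weight one, plus pair: if `Lie Hg ⊗ ℂ ⊆ ⟨B₀, C₀, Θ⟩` and `End_Hdg = ℚ` then `V^{1,0}` has only scalar endomorphisms
# (the commutant of `𝔰𝔩₂` on an isotypic module; Moonen–Zarhin (2.3), Deligne I §3)

Topic `Literature/AlgebraicGeometry/Motives` (namespace `Literature.AlgebraicGeometry.Motives.HodgeStructure`).  Theorems only
(no definition, no named fact; D-0026).  Sequel of `HodgeLieWeightOnePlusPairTwinIdeal` (the first branch of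
`exists_twin_ideal_of_plusPair`), written for the cell `pub-hodge-ring2` (literature lane gen 67, programme R44 step F3k; honest
framing of that cell: research route conditional on HC_CM; not a corollary; Q11.4-sentence-2 already refuted in dim ≥ 3 — this
file is unconditional).

* **`forall_end_piece_eq_smul_of_hodgeLieC_le_span`** — if `𝔥_ℂ ≤ 𝔰 = ⟨B₀, C₀, Θ⟩_ℂ` and `End_Hdg(V) = ℚ · 1`, then EVERY
  `ℂ`-linear endomorphism `k` of `P = V^{1,0}` is a scalar: the operator `K = k ⊕ μ₀⁻¹ C₀ k B₀` (i.e. `k` on `P`, `μ₀⁻¹ C₀ k B₀`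
  on `Q`) commutes with `B₀`, `C₀`, `Θ`, hence with `𝔥_ℂ`, so lies in `End_Hdg ⊗ ℂ = ℂ · 1`
  (`mem_span_endAlg_of_forall_commute`).  For abelian fivefolds (`dim P = 5`) this kills the first branch.

## References

* [MoonenZarhin1999LowDim] B. Moonen, Yu. Zarhin, *Hodge classes on abelian varieties of low dimension* (1999), §2 (2.3).
* [Deligne1982HodgeCycles] P. Deligne, *Hodge cycles on abelian varieties*, LNM 900 (1982), I §3, Prop. 3.4–3.6.
* [Zarhin1983HodgeGroupsK3] Yu. G. Zarhin, *Hodge groups of K3 surfaces*, J. reine angew. Math. 341 (1983), §2 (the commutant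
  of the Hodge Lie algebra is `End_Hdg`).
-/

open scoped TensorProduct

namespace Literature.AlgebraicGeometry.Motives

open Module

universe u

variable {V : Type u} [AddCommGroup V] [Module ℚ V] [Module.Finite ℚ V] [HodgeTensorFacts.{u, u}] {n : ℤ}

namespace HodgeStructure

set_option maxHeartbeats 800000 in
/-- **`𝔥_ℂ ≤ ⟨B₀, C₀, Θ⟩` and `End_Hdg = ℚ` force `End_ℂ(V^{1,0}) = ℂ`.**  For every `k ∈ End_ℂ(P)` the operator `K` equal to
`k` on `P` and to `μ₀⁻¹ C₀ k B₀` on `Q` commutes with `B₀`, `C₀` and `Θ` (check on `P` and `Q`, using `B₀C₀|_P = μ₀`, `C₀² = 0`,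
`B₀ P = 0`), hence with every `X_ℂ`, `X ∈ Lie Hg` (as `𝔥_ℂ ≤ ⟨B₀, C₀, Θ⟩`); so `K ∈ End_Hdg ⊗ ℂ`
(`mem_span_endAlg_of_forall_commute`) `= ℂ · 1`, and `k = K|_P` is a scalar.
[cite: MoonenZarhin1999LowDim, §2 (2.3)] [cite: Deligne1982HodgeCycles, I §3 Prop. 3.4–3.6] -/
theorem forall_end_piece_eq_smul_of_hodgeLieC_le_span (H : HodgeStructure V n) (hn : n = 1) (heff : H.IsEffective)
    {Θ : Module.End ℂ (ℂ ⊗[ℚ] V)} (hΘ : ∀ p, ∀ x ∈ H.piece p (n - p), Θ x = ((2 * p - n : ℤ) : ℂ) • x)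
    {B₀ C₀ : Module.End ℂ (ℂ ⊗[ℚ] V)} (hB₀P : ∀ p ∈ H.piece 1 0, B₀ p = 0) (hB₀im : ∀ v, B₀ v ∈ H.piece 1 0)
    (hC₀ : ∀ v, C₀ v = conj (B₀ (conj v))) {μ₀ : ℂ} (hμ₀ : μ₀ ≠ 0)
    (hBC : ∀ p ∈ H.piece 1 0, B₀ (C₀ p) = μ₀ • p) (hCB : ∀ q ∈ H.piece 0 1, C₀ (B₀ q) = μ₀ • q)
    (hle : H.hodgeLieC ≤ Submodule.span ℂ (Set.range ![B₀, C₀, Θ]))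
    (hE : ∀ a ∈ H.endAlg, ∃ x : ℚ, a = x • (1 : Module.End ℚ V)) :
    ∀ k : Module.End ℂ (H.piece 1 0), ∃ c : ℂ, k = c • (1 : Module.End ℂ (H.piece 1 0)) := by
  classical
  obtain ⟨hC₀Q, hC₀im, -, -, -, hext⟩ := PlusPairTwin.facts H hn heff hΘ hB₀P hB₀im hC₀ hBC hCB
  subst hn
  obtain ⟨hPmem, hQmem, hΘ10, hΘ01, -⟩ := UnitaryTheta.theta_facts H rfl heff hΘ
  intro k
  -- the projection `π_P = (1 + Θ)/2 : V_ℂ → P` and `B₀ : V_ℂ → P`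
  let πP : ℂ ⊗[ℚ] V →ₗ[ℂ] H.piece 1 0 :=
    LinearMap.codRestrict (H.piece 1 0) ((2 : ℂ)⁻¹ • (1 + Θ)) fun v => by
      simpa only [LinearMap.smul_apply, LinearMap.add_apply, Module.End.one_apply] using hPmem v
  let B₀' : ℂ ⊗[ℚ] V →ₗ[ℂ] H.piece 1 0 := LinearMap.codRestrict (H.piece 1 0) B₀ hB₀im
  have hπP : ∀ p ∈ H.piece 1 0, ((πP p : H.piece 1 0) : ℂ ⊗[ℚ] V) = p := fun p hp => by
    change ((2 : ℂ)⁻¹ • (1 + Θ)) p = p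
    rw [LinearMap.smul_apply, LinearMap.add_apply, Module.End.one_apply, hΘ10 p hp]; module
  have hπQ : ∀ q ∈ H.piece 0 1, πP q = 0 := fun q hq => by
    apply Subtype.ext
    change ((2 : ℂ)⁻¹ • (1 + Θ)) q = 0
    rw [LinearMap.smul_apply, LinearMap.add_apply, Module.End.one_apply, hΘ01 q hq, add_neg_cancel, smul_zero]
  have hπP' : ∀ p (hp : p ∈ H.piece 1 0), πP p = ⟨p, hp⟩ := fun p hp => Subtype.ext (hπP p hp)
  have hB₀'P : ∀ p ∈ H.piece 1 0, B₀' p = 0 := fun p hp => Subtype.ext (hB₀P p hp)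
  have hB₀'v : ∀ v, ((B₀' v : H.piece 1 0) : ℂ ⊗[ℚ] V) = B₀ v := fun v => rfl
  -- the operator `K = k ∘ π_P + μ₀⁻¹ C₀ k B₀`
  set K : Module.End ℂ (ℂ ⊗[ℚ] V) :=
    (H.piece 1 0).subtype ∘ₗ k ∘ₗ πP + μ₀⁻¹ • (C₀ ∘ₗ (H.piece 1 0).subtype ∘ₗ k ∘ₗ B₀') with hKdef
  have hKP : ∀ p (hp : p ∈ H.piece 1 0), K p = (k ⟨p, hp⟩ : ℂ ⊗[ℚ] V) := fun p hp => by
    simp only [hKdef, LinearMap.add_apply, LinearMap.smul_apply, LinearMap.comp_apply, hπP' p hp, hB₀'P p hp, map_zero,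
      Submodule.subtype_apply, smul_zero, add_zero]
  have hKQ : ∀ q ∈ H.piece 0 1, K q = μ₀⁻¹ • C₀ (k (B₀' q) : ℂ ⊗[ℚ] V) := fun q hq => by
    simp only [hKdef, LinearMap.add_apply, LinearMap.smul_apply, LinearMap.comp_apply, hπQ q hq, map_zero,
      Submodule.subtype_apply, zero_add]
  clear_value K
  have hkP : ∀ x : H.piece 1 0, ((k x : H.piece 1 0) : ℂ ⊗[ℚ] V) ∈ H.piece 1 0 := fun x => (k x).2
  have hC₀C₀ : ∀ v, C₀ (C₀ v) = 0 := fun v => hC₀Q _ (hC₀im v)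
  -- `K` commutes with `B₀`, `C₀`, `Θ`
  have hKB : K * B₀ = B₀ * K :=
    hext _ _ (fun p hp => by
        rw [Module.End.mul_apply, Module.End.mul_apply, hB₀P p hp, map_zero, hKP p hp, hB₀P _ (hkP _)])
      (fun q hq => by
        rw [Module.End.mul_apply, Module.End.mul_apply, hKP _ (hB₀im q), hKQ q hq, map_smul, hBC _ (hkP _), smul_smul,
          inv_mul_cancel₀ hμ₀, one_smul]
        rfl)
  have hKC : K * C₀ = C₀ * K :=
    hext _ _ (fun p hp => by
        rw [Module.End.mul_apply, Module.End.mul_apply, hKQ _ (hC₀im p), hKP p hp]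
        have hB : B₀' (C₀ p) = μ₀ • (⟨p, hp⟩ : H.piece 1 0) := Subtype.ext (by
          rw [hB₀'v, Submodule.coe_smul, hBC p hp])
        rw [hB, map_smul, Submodule.coe_smul, map_smul, smul_smul, inv_mul_cancel₀ hμ₀, one_smul])
      (fun q hq => by
        rw [Module.End.mul_apply, Module.End.mul_apply, hC₀Q q hq, map_zero, hKQ q hq, map_smul, hC₀C₀, smul_zero])
  have hKΘ : K * Θ = Θ * K :=
    hext _ _ (fun p hp => by
        rw [Module.End.mul_apply, Module.End.mul_apply, hΘ10 p hp, hKP p hp, hΘ10 _ (hkP _)])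
      (fun q hq => by
        rw [Module.End.mul_apply, Module.End.mul_apply, hΘ01 q hq, map_neg, hKQ q hq, map_smul, hΘ01 _ (hC₀im _),
          smul_neg])
  -- hence with `𝔰 ⊇ 𝔥_ℂ ∋ X_ℂ`
  have hK𝔰 : ∀ s ∈ Submodule.span ℂ (Set.range ![B₀, C₀, Θ]), K * s = s * K := by
    intro s hs
    induction hs using Submodule.span_induction with
    | mem x hx =>
      obtain ⟨i, rfl⟩ := hx
      fin_cases i
      · exact hKB
      · exact hKC
      · exact hKΘ
    | zero => rw [mul_zero, zero_mul]
    | add x y _ _ hx hy => rw [mul_add, add_mul, hx, hy]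
    | smul c x _ hx => rw [mul_smul_comm, smul_mul_assoc, hx]
  have hKcomm : ∀ X ∈ H.hodgeLie, K * X.baseChange ℂ = X.baseChange ℂ * K := fun X hX =>
    hK𝔰 _ (hle (H.baseChange_mem_hodgeLieC hX))
  -- so `K ∈ End_Hdg ⊗ ℂ = ℂ · 1`
  have hKspan := mem_span_endAlg_of_forall_commute H hKcomm
  have hle1 : Submodule.span ℂ ((fun a : Module.End ℚ V => a.baseChange ℂ) '' (H.endAlg : Set (Module.End ℚ V))) ≤
      Submodule.span ℂ {(1 : Module.End ℂ (ℂ ⊗[ℚ] V))} := by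
    rw [Submodule.span_le]
    rintro _ ⟨a, ha, rfl⟩
    obtain ⟨x, rfl⟩ := hE a ha
    change (x • (1 : Module.End ℚ V)).baseChange ℂ ∈ Submodule.span ℂ {(1 : Module.End ℂ (ℂ ⊗[ℚ] V))}
    rw [LinearMap.baseChange_smul, LinearMap.baseChange_one]
    exact Submodule.smul_of_tower_mem _ x (Submodule.subset_span rfl)
  obtain ⟨c, hc⟩ := Submodule.mem_span_singleton.1 (hle1 hKspan)
  refine ⟨c, LinearMap.ext fun p => Subtype.ext ?_⟩
  rw [LinearMap.smul_apply, Module.End.one_apply, Submodule.coe_smul]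
  have h := LinearMap.congr_fun hc (p : ℂ ⊗[ℚ] V)
  rw [LinearMap.smul_apply, Module.End.one_apply, hKP _ p.2] at h
  rw [← h]

end HodgeStructure

end Literature.AlgebraicGeometry.Motives
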